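import Summits.BirchSwinnertonDyer.BirchSwinnertonDyer.Theses.UniversalToricDescent
import Summits.BirchSwinnertonDyer.BirchSwinnertonDyer.Theorems.UniversalToricDescentRationalSplitIMCInclusionAtThreeClosedModuloV89

/-!
# G29 — supply census at a wild supercuspidal split prime; brief items (α)(γ)(δ) of g28 closed

Crux (fixed, by name): `…Theses.UniversalToricDescent.RationalSplitIMCInclusionAtThree`
(Kolyvagin direction `Ch_Λ(X_(∅,0)) ∣ 3ᵏ·L` in `R₀⟦T⟧`, `E/ℚ` wild additive `ClassO6` at `3`
(supercuspidal, `a₃ = 0`), `ρ̄₃` onto, `r_an = 1`, `K` Heegner with `3 = 𝔭𝔭'` split, `𝔭'` strict).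

This generation files NO new idea card: every positive lever examined reduces to a cone entry or dies
(HANDOFF-cruxidea-24207-1-g29.md «Dead / in-cone g29», 27 entries).  Its product is
(i) the closure of the three g28 brief items with kernel-checked toys (§A (α), §B (γ), §C is used by (δ)'s
sibling B-g29-4), (ii) three new barrier notes B-g29-3/4/5 fencing the remaining HOST and CARRIER classes,
and (iii) the SUPPLY CENSUS below, whose door (§D) is the LEAD composition BY NAME — after g29 the only
supply class not fenced by a recorded barrier is S1 (Beilinson–Flach along the ordinary CM family through
`θ_ψ`, specialised at `f_E`; LEAD `Lines/ratwall_thin_comb.lean` v12, open part = the half-ordinary value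
formula, Gu arXiv:2512.01184 Conj. 2.15, Loeffler arXiv:2003.13738 Conj. 2.8).

## Supply census (Kolyvagin direction, `f` fixed supercuspidal at the split prime 3)
* S1 `K`-theoretic / Eisenstein-symbol classes on products of modular curves restricted to the ORDINARY CM
  family (BF `f × θ_Ψ`): ALIVE = LEAD (door §D).  Diagonal classes need a second non-CM ordinary factor:
  none here (g8/g9, K1-DECISION utd-g60).
* S2 Kato's class on the cyclotomic line of `K`: one line of `Spec Λ_K`, no anticyclotomic germ
  (`Σ_{b≡a} φ(b/3ⁿ⁺¹) = a₃φ = 0`, mirror of trace-zero; B-utd-g50-2): transport through `Λ₂` = S1.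
* S3 determinant / ε-elements (rank-2 zeta element, Nakamura ε-iso): g18 `zeta-integrality-core-split`,
  g20; supply = conjecture (Kato–Sano), in-cone.
* FENCED (no supply): every CM-cycle supply in ANY host keeping a supercuspidal place over 3 is
  conductor-PRIMITIVE (B-g29-5 ⊇ TraceZero twins B-g5, B-g13 odd hosts); even-degree type-taming hosts are
  parity-locked AND Lubin–Tate-critical (B-g29-3 ⊇ B-g26-1, B-g5-7); vertical Kolyvagin derivatives of
  Heegner points are 3-torsion at every depth (B-g29-4 ⊇ B-g23-4); bipartite / level-raising systems need
  `U₃`-compatibility on both sides (B-g26-2, B-g28-3, NoAdmissiblePrimesAtThree); toothwise cofactor formats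
  are K2-rat or false (B-g29-1); classical-crossing statements carry only `μ/λ` (B-g29-2 = g6 piece A).

## Brief closures
* (α) toothwise symmetric cofactors — DEAD: Bezout lift `N_m = R_m G + S_m E_m`, `H_m := N_m·ρ(N_m)` is a
  legitimate symmetric cofactor per tooth, unit at the m-th crossing, yet `F·H_m ∈ (G, E_m)` for EVERY `F`;
  toy §A (`H(T,T) = −3`, a unit away from 3, while nothing is divisible).  Only g27's GLOBAL format informs.
* (γ) g14/g24 «E4: annihilator ∩ alternating ⇒ common root» — IN-CONE: any annihilator lies in every
  associated prime (§B, Mathlib `IsAssociatedPrime.annihilator_le` = g25's currency); on rigid rows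
  `X ∼ N ⊕ N`, `N ∼ Λ/(h)` and `3ᵏ𝓛 ∈ Ann N` ⟺ `h ∣ 3ᵏ𝓛` ⟺ g14's ONE leaf ⟺ the crux on the row
  (`h² ∣ 3²ᵏ𝓛²`, §B `sq_dvd_sq_of_dvd`); the alternating structure only re-derives (SQ) (g24).  Off rigid
  rows annihilation is WEAKER than the crux (lcm vs. product of elementary divisors) and has no supply of
  its own (θ-elements: B-g6-3; Kolyvagin systems: the supply problem itself).
* (δ) Kolyvagin at classical crossings — = g6 piece A (control ⇒ twisted Kolyvagin ⇒ `P_χ` torsion ⇒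
  p-adic Waldspurger); values at crossings `v(F(ζₙ−1)) = μ·φ(3ⁿ)+λ` see only `μ, λ` (B-g29-2); the
  relaxed-at-𝔭 classes are handled by Poitou–Tate against `y_{χ⁻¹}` and give the SAME condition
  `loc_{𝔭'} y_χ` torsion, which is symmetric under `𝔭 ↔ 𝔭'`, `χ ↔ χ⁻¹` (conjugation `c` and `τ₋₁`), so no
  orientation information either.

References: [cite: Gu2025FiniteSlopeUniversalRS, Conj. 2.15 (arXiv:2512.01184)] [cite: Nekovar2006, §10.7]
[cite: Castella2018, §2.2 (arXiv:1704.06608)] Mathlib `Mathlib.RingTheory.Ideal.AssociatedPrime.Basic`.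
-/

set_option autoImplicit false
set_option linter.dupNamespace false

namespace Summit.BirchSwinnertonDyer.BirchSwinnertonDyer.Cruxes.RationalSplitIMCInclusionAtThree.SupplyCensusG29

/-! ## §A  (α) toothwise cofactor dichotomy — the toy witness (B-g29-1)
`G = T₁+T₂+3`, `E = T₁−T₂`, Bezout `N = 2T₁+3` (`N ≡ 2G mod E`), `ρ(N) = 2T₂+3`; the symmetric element
`H := (2T₁+3)(T₁+T₂+3) − 4(T₂²+3T₂+3)` lies in `(G, E)` and restricts on the tooth `T₁ = T₂` to the
constant `−3`: a unit of `ℚ₃`-valuation 1, so `F·H ∈ (G,E)` for every `F` carries no divisibility. -/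

/-- B-g29-1 toy: on the tooth `T₁ = T₂ = T` the toothwise symmetric cofactor is the constant `−3`. -/
theorem toothwise_cofactor_on_tooth (T : ℤ) :
    (2 * T + 3) * (T + T + 3) - 4 * (T ^ 2 + 3 * T + 3) = -3 := by
  ring

/-- B-g29-1 toy, membership half: `H = 2·N·G − 4·(T₂²+3T₂+3)` with `N·G − 2(T₂²+3T₂+3) ∈ (E)`:
explicitly we record the exact identity
`H = (T₁ − T₂)·(2T₁ + 4T₂ + 9) + (−3)`, i.e. `H ≡ −3 (mod E)`. -/
theorem toothwise_cofactor_mod_tooth (T₁ T₂ : ℤ) :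
    (2 * T₁ + 3) * (T₁ + T₂ + 3) - 4 * (T₂ ^ 2 + 3 * T₂ + 3)
      = (T₁ - T₂) * (2 * T₁ + 4 * T₂ + 9) + (-3) := by
  ring

/-! ## §B  (γ) E4 collapse: annihilators lie in associated primes; square-root annihilation on a cyclic half
is the crux on that row -/

/-- Any annihilator of a module lies in each of its associated primes (Mathlib) — g25's
«annihilator ⊆ every supporting height-one prime» currency; the alternating structure is not used. -/
theorem annihilator_le_of_isAssociatedPrime {R : Type*} [CommRing R] {M : Type*} [AddCommGroup M]
    [Module R M] {P : Ideal R} (h : IsAssociatedPrime P M) :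
    (⊤ : Submodule R M).annihilator ≤ P :=
  h.annihilator_le

/-- Rigid-row half of E4: `h ∣ 𝓛` (square-root annihilation of the cyclic half `N ∼ Λ/(h)`) gives
`h² ∣ 𝓛²` (the crux on a row with `Ch = (h²)`, `L ≐ 𝓛²`) in any commutative monoid. -/
theorem sq_dvd_sq_of_dvd {S : Type*} [CommMonoid S] {h 𝓛 : S} (hd : h ∣ 𝓛) : h ^ 2 ∣ 𝓛 ^ 2 :=
  pow_dvd_pow_of_dvd hd 2

/-! ## §C  B-g29-4 depth-uniform 3-torsion of vertical Kolyvagin derivatives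
For `σ` generating `Gal(K_m/K_j)` (so `σ^{3^{m-j}} = 1`) acting on an object on which it has order dividing
`3^j`-th… precisely: on any commutative ring in which `x^{3^j} = 1` with `j + 1 ≤ m`, the last cyclotomic
factor `Φ_{3^m}(x) = 1 + x^{3^{m-1}} + x^{2·3^{m-1}}` EQUALS `3`.  Applied to the image of `σ` on
`E(K_{m,𝔭}) ⊗ (ℤ/3^{m-j})[G_{m/j}]`-coinvariant pieces fixed by `σ^{3^j}`, the residue at `𝔭` of every
vertical derivative class `[D_σ y_m]` is killed by `3`: generalises g23's one-step lemma to every depth. -/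

/-- B-g29-4 kernel: `x^{3^j} = 1`, `j+1 ≤ m` ⟹ `1 + x^{3^{m-1}} + x^{2·3^{m-1}} = 3`. -/
theorem cyclotomicFactor_three_pow_eq_three {R : Type*} [CommRing R] (x : R) (j m : ℕ)
    (hjm : j + 1 ≤ m) (hx : x ^ (3 ^ j) = 1) :
    1 + x ^ (3 ^ (m - 1)) + x ^ (2 * 3 ^ (m - 1)) = 3 := by
  have h1 : x ^ (3 ^ (m - 1)) = 1 := by
    obtain ⟨d, hd⟩ : ∃ d, m - 1 = j + d := ⟨m - 1 - j, by omega⟩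
    rw [hd, pow_add, pow_mul, hx, one_pow]
  have h2 : x ^ (2 * 3 ^ (m - 1)) = 1 := by
    rw [mul_comm, pow_mul, h1, one_pow]
  rw [h1, h2]
  norm_num

/-- B-g29-4, operator form: if `σ^{3^j} = 1` in a commutative ring then `Φ_{3^m}(σ)·y = 3·y` for every `y`
(`j+1 ≤ m`): norm-type elements built from `Φ_{3^m}(σ)` act as multiplication by `3`. -/
theorem cyclotomicFactor_smul_eq_three_smul {R : Type*} [CommRing R] (σ y : R) (j m : ℕ)
    (hjm : j + 1 ≤ m) (hσ : σ ^ (3 ^ j) = 1) :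
    (1 + σ ^ (3 ^ (m - 1)) + σ ^ (2 * 3 ^ (m - 1))) * y = 3 * y := by
  rw [cyclotomicFactor_three_pow_eq_three σ j m hjm hσ]

/-! ## §D  B-g29-5 toy and the census door
B-g29-5 (conductor-primitivity at a supercuspidal place): for a cuspidal representation of the finite
torus quotient the toric average of a matrix coefficient over a character TRIVIAL on the support vanishes;
the `GL₂(𝔽₃)`-shadow is the identity `(1/3)·1 + (2/3)·(−1/2) = 0` (the two non-trivial unipotent
translates of a cuspidal newvector pair to `−1/2` with it because their sum with the vector is `0`). -/

/-- B-g29-5 toy: the toric period of the trivial character against a cuspidal vector vanishes. -/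
theorem toric_period_trivial_character_toy : (1 : ℚ) / 3 * 1 + 2 / 3 * (-1 / 2) = 0 := by
  norm_num

/-- **CENSUS DOOR (S1, BY NAME).**  After g29 the only unfenced supply class is S1; its door is the LEAD
composition `V89.RationalSplitIMCInclusionAtThree_of_existsOfBDP_of_jacquet_of_nekovar_of_ratCombDvd`
(toric frame above the BDP frame ⊕ Jacquet ⊕ Nekovář ⊕ item 32493 `RatThinCombDvdUpToTwoAtThree` ⟹ the
crux BY NAME).  Re-exported verbatim: this node adds no new door (pieces: LEAD's, status UNDECIDED /
32493 = open conjecture in print), see the module docstring for why every other class is fenced. -/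
alias rationalSplitIMCInclusionAtThree_of_leadLine :=
  Summit.BirchSwinnertonDyer.BirchSwinnertonDyer.Theorems.UniversalToricDescentRatwallThinCombLine.V89.RationalSplitIMCInclusionAtThree_of_existsOfBDP_of_jacquet_of_nekovar_of_ratCombDvd

end Summit.BirchSwinnertonDyer.BirchSwinnertonDyer.Cruxes.RationalSplitIMCInclusionAtThree.SupplyCensusG29
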